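/-
Copyright (c) 2026. All rights reserved.
Released under Apache 2.0 license as described in the file LICENSE.
Authors: abc-iut cell, prover seat abc-iut-w6-d031 (gen 5; PROOF-ONLY support library for the cusp
analysis of uniformised punctured Riemann surfaces — [AbsTopIII] Prop 4.2 (i) geometric column).
-/
import Literature.Analysis.Complex.HalfPlaneDistortion
import Mathlib.Analysis.Complex.RemovableSingularity
import Mathlib.Analysis.Complex.AbsMax
import Mathlib.Analysis.SpecialFunctions.Complex.LogDeriv
import Mathlib.Analysis.SpecialFunctions.Log.Deriv
import HarnessLib

/-!
# Translation-equivariant holomorphic self-maps of the upper half-plane: cusps are parabolic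

Classical (A. F. Beardon, *The Geometry of Discrete Groups* (1983), §7.2 (the invariant
`|z - w|² / (Im z · Im w) = 2 (cosh ρ - 1)`), Thm. 7.35.1 (translation length of a hyperbolic element);
H. M. Farkas, I. Kra, *Riemann Surfaces* (1992), IV.5–IV.6: a puncture of `ℍ/Γ` is stabilised by a
PARABOLIC element).  The universal covering of the punctured disc `𝔻*` is `w ↦ e^{2πiw}` on the upper
half-plane `ℍₒ = {Im w > 0}` with deck transformation `w ↦ w + 1`; a holomorphic map `𝔻* → ℍₒ/⟨g⟩`
therefore unwinds to a holomorphic `F : ℍₒ → ℍₒ` with `F (w + 1) = g · F w`.  This PROOF-ONLY file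
(no definitions, no named facts) proves the two facts about such `F` that drive every «cusps ↔
punctures» argument:

* ★ `sq_trace_le_four_of_translationEquivariant` — **no hyperbolic monodromy**: if `F : ℍₒ → ℍₒ` is
  holomorphic and `F (w + 1) = (a F w + b)/(c F w + d)` with `ad - bc = 1`, then `(a + d)² ≤ 4`.
  Proof: Schwarz–Pick in the tree's form `|F′(ζ)| ≤ 2 Im F(ζ)/Im ζ`
  (`AreaThm.norm_deriv_le_two_mul_im_div`) integrated along `[w, w + 1]` at height `t` gives
  `|F(w+1) - F(w)|² ≤ (4e⁶/t²) · Im F(w) · Im F(w+1)` (`normSq_sub_le_of_mapsTo`), whereas a hyperbolic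
  Möbius map moves every point by at least its translation length:
  `((a+d)² - 4)/2 · Im z · Im gz ≤ |gz - z|²` (`translation_length_le`);
* `exists_descent_exp` — a `1`-periodic holomorphic function on `ℍₒ` descends through `e^{2πiw}` to a
  holomorphic function on the punctured unit disc;
* ★ `exists_limit_of_periodic_of_mapsTo` — **trivial monodromy ⇒ a limit inside `ℍₒ`**: a `1`-periodic
  holomorphic `F : ℍₒ → ℍₒ` converges, as `Im w → ∞`, to a point `τ` with `Im τ > 0` (Riemann's
  removable singularity theorem and the maximum modulus principle for the Cayley transform of the
  descended function).

Consumers (abc-iut cell, campaign-L geometric column of [AbsTopIII] Prop 4.2 (i)): the deck element of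
a puncture of a uniformised `X = ℍ/Λ̄` is parabolic (hypothesis (P) of
`HolRS.finiteIndex_subgroupOf_normalizer_of_cusps`), and the great Picard theorem via the `λ`-lift.
MODEL side only; nothing here bears on [IUTchIII] Cor. 3.12.

## References

* A. F. Beardon, *The Geometry of Discrete Groups*, GTM 91 (1983), §7.2, §7.35. [Beardon1983]
* H. M. Farkas, I. Kra, *Riemann Surfaces*, 2nd ed. (1992), IV.5.5–IV.5.6, IV.6. [FarkasKra1992]
-/

set_option autoImplicit false

noncomputable section

open Complex Filter Topology Metric Set Function
open scoped Real
open UpperHalfPlane (upperHalfPlaneSet isOpen_upperHalfPlaneSet)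

namespace Literature.Analysis.Complex

namespace TranslationEquivariant

/-! ### §1 Möbius algebra and the translation length of a hyperbolic element -/

/-- The denominator `c z + d` of a real Möbius map with `ad - bc = 1` does not vanish on `ℍₒ`.
[cite: Beardon1983, Section 7.2] -/
theorem denom_ne_zero {a b c d : ℝ} (had : a * d - b * c = 1) {z : ℂ} (hz : 0 < z.im) :
    (c : ℂ) * z + d ≠ 0 := by
  intro h
  have him : c * z.im = 0 := by simpa using congrArg Complex.im h
  have hc : c = 0 := by
    rcases mul_eq_zero.mp him with h' | h'
    · exact h'
    · exact absurd h' hz.ne'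
  have hre : c * z.re + d = 0 := by simpa using congrArg Complex.re h
  rw [hc, zero_mul, zero_add] at hre
  rw [hc, hre, mul_zero, mul_zero, sub_zero] at had
  exact zero_ne_one had

/-- `Im ((az+b)/(cz+d)) = Im z / |cz+d|²` for `ad - bc = 1`. [cite: Beardon1983, Section 7.2] -/
theorem moebius_im {a b c d : ℝ} (had : a * d - b * c = 1) (z : ℂ) :
    (((a : ℂ) * z + b) / ((c : ℂ) * z + d)).im = z.im / Complex.normSq ((c : ℂ) * z + d) := by
  have key : ((a : ℂ) * z + b).im * ((c : ℂ) * z + d).re -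
      ((a : ℂ) * z + b).re * ((c : ℂ) * z + d).im = z.im := by
    simp only [Complex.add_re, Complex.add_im, Complex.mul_re, Complex.mul_im, Complex.ofReal_re,
      Complex.ofReal_im, zero_mul, sub_zero, add_zero]
    linear_combination z.im * had
  rw [Complex.div_im, div_sub_div_same, key]

/-- A real Möbius map with `ad - bc = 1` preserves `ℍₒ`. [cite: Beardon1983, Section 7.2] -/
theorem moebius_im_pos {a b c d : ℝ} (had : a * d - b * c = 1) {z : ℂ} (hz : 0 < z.im) :
    0 < (((a : ℂ) * z + b) / ((c : ℂ) * z + d)).im := by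
  rw [moebius_im had z]
  exact div_pos hz (Complex.normSq_pos.mpr (denom_ne_zero had hz))

/-- `gz - z = -(c z² + (d - a) z - b)/(c z + d)`. [cite: Beardon1983, Section 7.2] -/
theorem moebius_sub_self {a b c d : ℝ} (had : a * d - b * c = 1) {z : ℂ} (hz : 0 < z.im) :
    ((a : ℂ) * z + b) / ((c : ℂ) * z + d) - z =
      -((c : ℂ) * (z * z) + ((d - a : ℝ) : ℂ) * z - b) / ((c : ℂ) * z + d) := by
  have hB := denom_ne_zero had hz
  rw [eq_div_iff hB, sub_mul, div_mul_cancel₀ _ hB]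
  push_cast
  ring

/-- **Translation length** (polynomial form): for all real `a b c d` and `z` with `Im z > 0`,
`((a + d)² - 4(ad - bc))/2 · (Im z)² ≤ |c z² + (d - a) z - b|²`.  (With `U = 2cz + (d - a)` and
`D = (d-a)² + 4bc` one has `4c·p(z) = U² - D` and `|U² - D|² - 2 D (Im U)² = ((Re U)² - D)² + (Im U)⁴
+ 2 (Re U)² (Im U)² ≥ 0`; for `c = 0` directly.) [cite: Beardon1983, Theorem 7.35.1] -/
theorem translation_length_poly_le (a b c d : ℝ) (z : ℂ) :
    ((a + d) ^ 2 - 4 * (a * d - b * c)) / 2 * z.im ^ 2 ≤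
      Complex.normSq ((c : ℂ) * (z * z) + ((d - a : ℝ) : ℂ) * z - b) := by
  set p : ℂ := (c : ℂ) * (z * z) + ((d - a : ℝ) : ℂ) * z - b with hp
  have hpre : p.re = c * (z.re * z.re - z.im * z.im) + (d - a) * z.re - b := by
    simp only [hp, Complex.sub_re, Complex.add_re, Complex.mul_re, Complex.mul_im, Complex.ofReal_re,
      Complex.ofReal_im, zero_mul, sub_zero]
  have hpim : p.im = c * (2 * z.re * z.im) + (d - a) * z.im := by
    simp only [hp, Complex.sub_im, Complex.add_im, Complex.mul_re, Complex.mul_im, Complex.ofReal_re,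
      Complex.ofReal_im, zero_mul, add_zero, sub_zero]
    ring
  by_cases hc : c = 0
  · -- `p = (d - a) z - b`, `D = (d - a)²`
    have key : Complex.normSq p - ((a + d) ^ 2 - 4 * (a * d - b * c)) / 2 * z.im ^ 2 =
        ((d - a) * z.re - b) ^ 2 + (d - a) ^ 2 * z.im ^ 2 / 2 := by
      rw [Complex.normSq_apply, hpre, hpim, hc]
      ring
    nlinarith [sq_nonneg ((d - a) * z.re - b), sq_nonneg ((d - a) * z.im), key]
  · set X : ℝ := 2 * c * z.re + (d - a) with hX
    set Y : ℝ := 2 * c * z.im with hY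
    set D : ℝ := (a + d) ^ 2 - 4 * (a * d - b * c) with hD
    have key : 16 * c ^ 2 * (Complex.normSq p - D / 2 * z.im ^ 2) =
        (X ^ 2 - D) ^ 2 + Y ^ 4 + 2 * X ^ 2 * Y ^ 2 := by
      rw [Complex.normSq_apply, hpre, hpim, hX, hY, hD]
      ring
    have hnn : 0 ≤ 16 * c ^ 2 * (Complex.normSq p - D / 2 * z.im ^ 2) := by
      rw [key]; positivity
    have hc2 : 0 < 16 * c ^ 2 := by positivity
    by_contra h
    push Not at h
    have : 16 * c ^ 2 * (Complex.normSq p - D / 2 * z.im ^ 2) < 0 :=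
      mul_neg_of_pos_of_neg hc2 (by linarith)
    linarith

/-- **Translation length of a Möbius map** `g = (az+b)/(cz+d)`, `ad - bc = 1`, acting on `ℍₒ`:
`((a + d)² - 4)/2 · Im z · Im gz ≤ |gz - z|²`; for hyperbolic `g` (`(a + d)² > 4`) the left side is a
positive multiple of `Im z · Im gz`, i.e. `cosh ρ(z, gz) - 1 ≥ ((a+d)² - 4)/4`.
[cite: Beardon1983, Theorem 7.35.1] -/
theorem translation_length_le {a b c d : ℝ} (had : a * d - b * c = 1) {z : ℂ} (hz : 0 < z.im) :
    ((a + d) ^ 2 - 4) / 2 * (z.im * (((a : ℂ) * z + b) / ((c : ℂ) * z + d)).im) ≤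
      Complex.normSq (((a : ℂ) * z + b) / ((c : ℂ) * z + d) - z) := by
  have hB := denom_ne_zero had hz
  have hN : 0 < Complex.normSq ((c : ℂ) * z + d) := Complex.normSq_pos.mpr hB
  rw [moebius_im had z, moebius_sub_self had hz, map_div₀, Complex.normSq_neg]
  have hpoly := translation_length_poly_le a b c d z
  rw [had, mul_one] at hpoly
  rw [show ((a + d) ^ 2 - 4) / 2 * (z.im * (z.im / Complex.normSq ((c : ℂ) * z + d))) =
      (((a + d) ^ 2 - 4) / 2 * z.im ^ 2) / Complex.normSq ((c : ℂ) * z + d) by ring]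
  exact div_le_div_of_nonneg_right hpoly hN.le

/-! ### §2 Schwarz–Pick along a horizontal unit segment -/

/-- Imaginary part of a path derivative (slope characterisation).
-- adapted from Literature/Analysis/Complex/FlatBoundaryPoissonExpansion.lean
[folklore] -/
private theorem hasDerivAt_im_comp {e : ℝ → ℂ} {e' : ℂ} {s : ℝ} (h : HasDerivAt e e' s) :
    HasDerivAt (fun s => (e s).im) e'.im s := by
  rw [hasDerivAt_iff_tendsto_slope_zero] at h ⊢
  have hc : Tendsto (fun t : ℝ => (t⁻¹ • (e (s + t) - e s)).im) (𝓝[≠] 0) (𝓝 e'.im) :=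
    (continuous_im.tendsto _).comp h
  refine hc.congr fun t => ?_
  simp only [smul_eq_mul, sub_im, Complex.real_smul, mul_im, ofReal_re, ofReal_im, zero_mul,
    add_zero]

section SchwarzPick

variable {F : ℂ → ℂ} (hF : DifferentiableOn ℂ F upperHalfPlaneSet)
  (hmaps : MapsTo F upperHalfPlaneSet upperHalfPlaneSet)

include hF hmaps

omit hmaps in
/-- The real curve `s ↦ F (w + s)` has derivative `F′(w + s)`. [folklore] -/
private theorem hasDerivAt_comp_add_ofReal {w : ℂ} (hw : 0 < w.im) (s : ℝ) :
    HasDerivAt (fun s : ℝ => F (w + (s : ℂ))) (deriv F (w + s)) s := by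
  have hws : w + (s : ℂ) ∈ upperHalfPlaneSet := by
    show 0 < (w + (s : ℂ)).im
    simpa using hw
  have hFd : HasDerivAt F (deriv F (w + s)) (w + (s : ℂ)) :=
    (hF.differentiableAt (isOpen_upperHalfPlaneSet.mem_nhds hws)).hasDerivAt
  have h1 : HasDerivAt (fun u : ℂ => F (w + u)) (deriv F (w + s)) (s : ℂ) :=
    HasDerivAt.comp_const_add w (s : ℂ) hFd
  exact h1.comp_ofReal

/-- **Harnack along `[w, w+1]`**: `|log Im F(w + s) - log Im F(w)| ≤ 2s/Im w` for `s ∈ [0, 1]` — the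
Schwarz–Pick bound `|F′| ≤ 2 Im F / Im w` integrated. [cite: Beardon1983, Section 7.2] -/
theorem abs_log_im_sub_log_im_le {w : ℂ} (hw : 0 < w.im) {s : ℝ} (hs : s ∈ Icc (0 : ℝ) 1) :
    |Real.log (F (w + (s : ℂ))).im - Real.log (F w).im| ≤ 2 / w.im * s := by
  have hmem : ∀ u : ℝ, w + (u : ℂ) ∈ upperHalfPlaneSet := fun u => by
    show 0 < (w + (u : ℂ)).im
    simpa using hw
  have hpos : ∀ u : ℝ, 0 < (F (w + (u : ℂ))).im := fun u => hmaps (hmem u)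
  -- derivative of `u ↦ log Im F (w + u)`
  have hder : ∀ u : ℝ, HasDerivAt (fun u : ℝ => Real.log (F (w + (u : ℂ))).im)
      ((deriv F (w + u)).im / (F (w + (u : ℂ))).im) u := fun u => by
    have h1 := hasDerivAt_comp_add_ofReal hF hw u
    have h2 : HasDerivAt (fun u : ℝ => (F (w + (u : ℂ))).im) ((deriv F (w + u)).im) u :=
      hasDerivAt_im_comp h1
    exact h2.log (hpos u).ne'
  have hbound : ∀ u ∈ Ico (0 : ℝ) 1, ‖(deriv F (w + u)).im / (F (w + (u : ℂ))).im‖ ≤ 2 / w.im := by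
    intro u _
    have hSP := AreaThm.norm_deriv_le_two_mul_im_div hF hmaps (hmem u)
    have himw : (w + (u : ℂ)).im = w.im := by simp
    rw [himw] at hSP
    rw [Real.norm_eq_abs, abs_div, abs_of_pos (hpos u)]
    calc |(deriv F (w + u)).im| / (F (w + (u : ℂ))).im ≤ ‖deriv F (w + u)‖ / (F (w + (u : ℂ))).im :=
          div_le_div_of_nonneg_right (Complex.abs_im_le_norm _) (hpos u).le
      _ ≤ (2 * (F (w + (u : ℂ))).im / w.im) / (F (w + (u : ℂ))).im :=
          div_le_div_of_nonneg_right hSP (hpos u).le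
      _ = 2 / w.im := by
          have hm : (F (w + (u : ℂ))).im ≠ 0 := (hpos u).ne'
          field_simp
  have hMVT := norm_image_sub_le_of_norm_deriv_le_segment' (a := (0 : ℝ)) (b := 1)
    (fun u _ => (hder u).hasDerivWithinAt) hbound s hs
  simpa [Real.norm_eq_abs] using hMVT

/-- `Im F(w + s) ≤ e^{2/Im w} Im F(w)` for `s ∈ [0,1]`. [cite: Beardon1983, Section 7.2] -/
theorem im_le_exp_mul_im {w : ℂ} (hw : 0 < w.im) {s : ℝ} (hs : s ∈ Icc (0 : ℝ) 1) :
    (F (w + (s : ℂ))).im ≤ Real.exp (2 / w.im) * (F w).im := by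
  have hmem : ∀ u : ℝ, w + (u : ℂ) ∈ upperHalfPlaneSet := fun u => by
    show 0 < (w + (u : ℂ)).im
    simpa using hw
  have hpos_s : 0 < (F (w + (s : ℂ))).im := hmaps (hmem s)
  have hpos_0 : 0 < (F w).im := by simpa using hmaps (hmem 0)
  have h := abs_log_im_sub_log_im_le hF hmaps hw hs
  have h' : Real.log (F (w + (s : ℂ))).im ≤ Real.log (F w).im + 2 / w.im := by
    have h2s : 2 / w.im * s ≤ 2 / w.im :=
      by nlinarith [hs.2, div_nonneg (zero_le_two) hw.le]
    linarith [(abs_le.mp (h.trans h2s)).2]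
  calc (F (w + (s : ℂ))).im = Real.exp (Real.log (F (w + (s : ℂ))).im) := (Real.exp_log hpos_s).symm
    _ ≤ Real.exp (Real.log (F w).im + 2 / w.im) := Real.exp_le_exp.mpr h'
    _ = Real.exp (2 / w.im) * (F w).im := by rw [Real.exp_add, Real.exp_log hpos_0, mul_comm]

/-- `Im F(w) ≤ e^{2/Im w} Im F(w + 1)`. [cite: Beardon1983, Section 7.2] -/
theorem im_le_exp_mul_im_add_one {w : ℂ} (hw : 0 < w.im) :
    (F w).im ≤ Real.exp (2 / w.im) * (F (w + 1)).im := by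
  have hmem : ∀ u : ℝ, w + (u : ℂ) ∈ upperHalfPlaneSet := fun u => by
    show 0 < (w + (u : ℂ)).im
    simpa using hw
  have hpos_1 : 0 < (F (w + 1)).im := by simpa using hmaps (hmem 1)
  have hpos_0 : 0 < (F w).im := by simpa using hmaps (hmem 0)
  have h := abs_log_im_sub_log_im_le hF hmaps hw (s := 1) ⟨zero_le_one, le_rfl⟩
  simp only [Complex.ofReal_one, mul_one] at h
  have h' : Real.log (F w).im ≤ Real.log (F (w + 1)).im + 2 / w.im := by
    linarith [(abs_le.mp h).1]
  calc (F w).im = Real.exp (Real.log (F w).im) := (Real.exp_log hpos_0).symm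
    _ ≤ Real.exp (Real.log (F (w + 1)).im + 2 / w.im) := Real.exp_le_exp.mpr h'
    _ = Real.exp (2 / w.im) * (F (w + 1)).im := by rw [Real.exp_add, Real.exp_log hpos_1, mul_comm]

/-- `|F(w+1) - F(w)| ≤ 2 e^{2/Im w} Im F(w) / Im w`. [cite: Beardon1983, Section 7.2] -/
theorem norm_sub_le_of_mapsTo {w : ℂ} (hw : 0 < w.im) :
    ‖F (w + 1) - F w‖ ≤ 2 * Real.exp (2 / w.im) * (F w).im / w.im := by
  have hmem : ∀ u : ℝ, w + (u : ℂ) ∈ upperHalfPlaneSet := fun u => by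
    show 0 < (w + (u : ℂ)).im
    simpa using hw
  have hbound : ∀ u ∈ Ico (0 : ℝ) 1, ‖deriv F (w + u)‖ ≤ 2 * Real.exp (2 / w.im) * (F w).im / w.im := by
    intro u hu
    have hSP := AreaThm.norm_deriv_le_two_mul_im_div hF hmaps (hmem u)
    have himw : (w + (u : ℂ)).im = w.im := by simp
    rw [himw] at hSP
    have h2 := im_le_exp_mul_im hF hmaps hw (Ico_subset_Icc_self hu)
    calc ‖deriv F (w + u)‖ ≤ 2 * (F (w + (u : ℂ))).im / w.im := hSP
      _ ≤ 2 * (Real.exp (2 / w.im) * (F w).im) / w.im := by gcongr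
      _ = 2 * Real.exp (2 / w.im) * (F w).im / w.im := by ring
  have hMVT := norm_image_sub_le_of_norm_deriv_le_segment' (a := (0 : ℝ)) (b := 1)
    (fun u _ => (hasDerivAt_comp_add_ofReal hF hw u).hasDerivWithinAt) hbound 1
    ⟨zero_le_one, le_rfl⟩
  simpa using hMVT

/-- **Schwarz–Pick across one period**: for `Im w ≥ 1`,
`|F(w+1) - F(w)|² ≤ (4e⁶ / (Im w)²) · Im F(w) · Im F(w+1)` — the hyperbolic displacement
`cosh ρ(F w, F(w+1)) - 1` is `O(1/(Im w)²)`, as `ρ(w, w+1) → 0`. [cite: Beardon1983, Section 7.2] -/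
theorem normSq_sub_le_of_mapsTo {w : ℂ} (hw : 1 ≤ w.im) :
    Complex.normSq (F (w + 1) - F w) ≤
      4 * Real.exp 6 / w.im ^ 2 * ((F w).im * (F (w + 1)).im) := by
  have hw0 : 0 < w.im := lt_of_lt_of_le one_pos hw
  have hmem : ∀ u : ℝ, w + (u : ℂ) ∈ upperHalfPlaneSet := fun u => by
    show 0 < (w + (u : ℂ)).im
    simpa using hw0
  have hpos_1 : 0 < (F (w + 1)).im := by simpa using hmaps (hmem 1)
  have hpos_0 : 0 < (F w).im := by simpa using hmaps (hmem 0)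
  have hexp : Real.exp (2 / w.im) ≤ Real.exp 2 := by
    apply Real.exp_le_exp.mpr
    rw [div_le_iff₀ hw0]
    nlinarith
  have hΔ := norm_sub_le_of_mapsTo hF hmaps hw0
  have him := im_le_exp_mul_im_add_one hF hmaps hw0
  set m0 := (F w).im
  set m1 := (F (w + 1)).im
  set E := Real.exp (2 / w.im) with hE
  have hE0 : 0 < E := Real.exp_pos _
  have hsq : Complex.normSq (F (w + 1) - F w) ≤ (2 * E * m0 / w.im) ^ 2 := by
    rw [Complex.normSq_eq_norm_sq]
    exact pow_le_pow_left₀ (norm_nonneg _) hΔ 2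
  have hE3 : E ^ 3 ≤ Real.exp 6 := by
    calc E ^ 3 ≤ Real.exp 2 ^ 3 := pow_le_pow_left₀ hE0.le hexp 3
      _ = Real.exp ((3 : ℕ) * 2) := (Real.exp_nat_mul 2 3).symm
      _ = Real.exp 6 := by norm_num
  calc Complex.normSq (F (w + 1) - F w) ≤ (2 * E * m0 / w.im) ^ 2 := hsq
    _ = 4 * E ^ 2 / w.im ^ 2 * (m0 * m0) := by ring
    _ ≤ 4 * E ^ 2 / w.im ^ 2 * (m0 * (E * m1)) := by gcongr
    _ = 4 * E ^ 3 / w.im ^ 2 * (m0 * m1) := by ring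
    _ ≤ 4 * Real.exp 6 / w.im ^ 2 * (m0 * m1) := by gcongr

end SchwarzPick

/-! ### §3 No hyperbolic monodromy -/

/-- ★ **Cusps are parabolic (no hyperbolic monodromy).**  If `F : ℍₒ → ℍₒ` is holomorphic and
translation-equivariant for a real Möbius map, `F (w + 1) = (a F w + b)/(c F w + d)` with
`ad - bc = 1`, then `(a + d)² ≤ 4`: the monodromy is parabolic, elliptic or `±1`, never hyperbolic.
(At height `t`, Schwarz–Pick makes the hyperbolic displacement of `F w ↦ F(w+1)` at most `4e⁶/t²`
times `Im · Im`, while a hyperbolic element displaces every point by at least `((a+d)² - 4)/2` in the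
same units.) [cite: Beardon1983, Theorem 7.35.1] [cite: FarkasKra1992, IV.5.5–IV.5.6] -/
theorem sq_trace_le_four_of_translationEquivariant {F : ℂ → ℂ}
    (hF : DifferentiableOn ℂ F upperHalfPlaneSet) (hmaps : MapsTo F upperHalfPlaneSet upperHalfPlaneSet)
    {a b c d : ℝ} (had : a * d - b * c = 1)
    (heq : ∀ w : ℂ, 0 < w.im → F (w + 1) = ((a : ℂ) * F w + b) / ((c : ℂ) * F w + d)) :
    (a + d) ^ 2 ≤ 4 := by
  by_contra hD
  push Not at hD
  set D : ℝ := (a + d) ^ 2 - 4 with hDdef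
  have hD0 : 0 < D := by rw [hDdef]; linarith
  -- a height `t ≥ 1` with `4e⁶/t² < D/2`
  set t : ℝ := max 1 (8 * Real.exp 6 / D + 1) with ht
  have ht1 : 1 ≤ t := le_max_left _ _
  have ht0 : 0 < t := lt_of_lt_of_le one_pos ht1
  have htD : 8 * Real.exp 6 / D < t := lt_of_lt_of_le (lt_add_one _) (le_max_right _ _)
  set w : ℂ := (t : ℂ) * I with hw
  have hwim : w.im = t := by simp [hw]
  have hw0 : 0 < w.im := hwim ▸ ht0
  set z : ℂ := F w with hz
  have hzim : 0 < z.im := hmaps hw0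
  have hB := denom_ne_zero had hzim
  have hN : 0 < Complex.normSq ((c : ℂ) * z + d) := Complex.normSq_pos.mpr hB
  -- the two bounds
  have hlow := translation_length_le had hzim
  have hup := normSq_sub_le_of_mapsTo hF hmaps (w := w) (hwim ▸ ht1)
  rw [heq w hw0, ← hz, hwim] at hup
  rw [← hDdef] at hlow
  -- `D/2 · (Im z · Im gz) ≤ K · (Im z · Im gz)` with `K = 4e⁶/t²`
  have hprod : 0 < z.im * (((a : ℂ) * z + b) / ((c : ℂ) * z + d)).im :=
    mul_pos hzim (moebius_im_pos had hzim)
  have hK : D / 2 ≤ 4 * Real.exp 6 / t ^ 2 := le_of_mul_le_mul_right (hlow.trans hup) hprod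
  -- but `4e⁶/t² ≤ 4e⁶/t < D/2`
  have h1 : 4 * Real.exp 6 / t ^ 2 ≤ 4 * Real.exp 6 / t := by
    apply div_le_div_of_nonneg_left (by positivity) ht0
    nlinarith
  have h2 : 4 * Real.exp 6 / t < D / 2 := by
    rw [div_lt_iff₀ ht0]
    have := (div_lt_iff₀ hD0).mp htD
    linarith
  linarith

/-! ### §4 Descent of `1`-periodic holomorphic functions through `w ↦ e^{2πiw}` -/

/-- `|e^{2πiw}| = e^{-2π Im w}`. [cite: FarkasKra1992, IV.5.5–IV.5.6] -/
theorem norm_exp_two_pi_I_mul (w : ℂ) : ‖exp (2 * π * I * w)‖ = Real.exp (-2 * π * w.im) := by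
  rw [Complex.norm_exp]
  congr 1
  simp only [Complex.mul_re, Complex.mul_im, Complex.ofReal_re, Complex.ofReal_im, Complex.I_re,
    Complex.I_im, Complex.re_ofNat, Complex.im_ofNat]
  ring

/-- For `Im w > 0`, `e^{2πiw}` lies in the punctured unit disc. [cite: FarkasKra1992, IV.5.5–IV.5.6] -/
theorem exp_mem_puncturedDisc {w : ℂ} (hw : 0 < w.im) :
    exp (2 * π * I * w) ∈ ball (0 : ℂ) 1 \ {0} := by
  refine ⟨?_, exp_ne_zero _⟩
  rw [mem_ball_zero_iff, norm_exp_two_pi_I_mul, ← Real.exp_zero, Real.exp_lt_exp]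
  nlinarith [Real.pi_pos]

/-- The branch `ℓ z = log z / (2πi)` of the inverse: `e^{2πi ℓ z} = z`. [cite: FarkasKra1992, IV.5.5–IV.5.6] -/
theorem exp_logBranch {z : ℂ} (hz : z ≠ 0) : exp (2 * π * I * (log z / (2 * π * I))) = z := by
  rw [mul_div_cancel₀ _ (by simp [Real.pi_ne_zero, I_ne_zero] : (2 * π * I : ℂ) ≠ 0)]
  exact exp_log hz

/-- `Im (log z / (2πi)) = - log ‖z‖ / (2π)`. [folklore] -/
private theorem im_logBranch (z : ℂ) : (log z / (2 * π * I)).im = -Real.log ‖z‖ / (2 * π) := by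
  have hre : (2 * π * I : ℂ).re = 0 := by simp
  have him : (2 * π * I : ℂ).im = 2 * π := by simp
  have hn : Complex.normSq (2 * π * I : ℂ) = (2 * π) ^ 2 := by
    rw [Complex.normSq_apply, hre, him]; ring
  rw [Complex.div_im, hre, him, hn, Complex.log_re]
  have hπ : (2 * π) ≠ 0 := by positivity
  field_simp
  ring

/-- For `0 < ‖z‖ < 1` the branch `log z / (2πi)` lies in `ℍₒ`. [cite: FarkasKra1992, IV.5.5–IV.5.6] -/
theorem im_logBranch_pos {z : ℂ} (hz : z ≠ 0) (hz1 : ‖z‖ < 1) : 0 < (log z / (2 * π * I)).im := by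
  rw [im_logBranch]
  have : Real.log ‖z‖ < 0 := Real.log_neg (norm_pos_iff.mpr hz) hz1
  have h2 : 0 < 2 * π := by positivity
  exact div_pos (by linarith) h2

section Descent

variable {F : ℂ → ℂ} (hper : ∀ w : ℂ, 0 < w.im → F (w + 1) = F w)

include hper

/-- A `1`-periodic function on `ℍₒ` is `ℤ`-periodic there. [cite: FarkasKra1992, IV.5.5–IV.5.6] -/
theorem periodic_int (n : ℤ) {w : ℂ} (hw : 0 < w.im) : F (w + n) = F w := by
  have hnat : ∀ (k : ℕ) (u : ℂ), 0 < u.im → F (u + k) = F u := by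
    intro k
    induction k with
    | zero => intro u _; simp
    | succ k ih =>
      intro u hu
      have : u + ((k + 1 : ℕ) : ℂ) = (u + k) + 1 := by push_cast; ring
      rw [this, hper _ (by simpa using hu), ih u hu]
  obtain ⟨k, rfl | rfl⟩ := n.eq_nat_or_neg
  · exact_mod_cast hnat k w hw
  · have hu : 0 < (w + ((-(k : ℤ) : ℤ) : ℂ)).im := by simpa using hw
    have := hnat k (w + ((-(k : ℤ) : ℤ) : ℂ)) hu
    rw [← this]
    congr 1
    push_cast
    ring

/-- Two points of `ℍₒ` with the same image under `e^{2πiw}` have the same `F`-value. [cite: FarkasKra1992, IV.5.5–IV.5.6] -/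
theorem eq_of_exp_eq {w w' : ℂ} (hw' : 0 < w'.im)
    (h : exp (2 * π * I * w) = exp (2 * π * I * w')) : F w = F w' := by
  obtain ⟨n, hn⟩ := Complex.exp_eq_exp_iff_exists_int.mp h
  have h2 : (2 * π * I : ℂ) ≠ 0 := by simp [Real.pi_ne_zero, I_ne_zero]
  have hww : w = w' + n := by
    have h3 : 2 * π * I * w = 2 * π * I * (w' + n) := by rw [hn]; ring
    exact mul_left_cancel₀ h2 h3
  rw [hww]
  exact periodic_int hper n hw'

/-- ★ **Descent through `e^{2πiw}`.**  A `1`-periodic function `F`, holomorphic on `ℍₒ`, is of the form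
`F w = G (e^{2πiw})` with `G` holomorphic on the punctured unit disc `0 < |z| < 1` (namely
`G z = F (log z / 2πi)`, independent of the branch). [cite: FarkasKra1992, IV.5.5–IV.5.6] -/
theorem exists_descent_exp (hF : DifferentiableOn ℂ F upperHalfPlaneSet) :
    ∃ G : ℂ → ℂ, DifferentiableOn ℂ G (ball (0 : ℂ) 1 \ {0}) ∧
      (∀ w : ℂ, 0 < w.im → G (exp (2 * π * I * w)) = F w) ∧
      ∀ z : ℂ, z ≠ 0 → ‖z‖ < 1 → ∃ w : ℂ, 0 < w.im ∧ exp (2 * π * I * w) = z ∧ G z = F w := by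
  have h2 : (2 * π * I : ℂ) ≠ 0 := by simp [Real.pi_ne_zero, I_ne_zero]
  let G : ℂ → ℂ := fun z => F (log z / (2 * π * I))
  have hGE : ∀ w : ℂ, 0 < w.im → G (exp (2 * π * I * w)) = F w := fun w hw => by
    obtain ⟨hb, hne⟩ := exp_mem_puncturedDisc hw
    have hne : exp (2 * π * I * w) ≠ 0 := hne
    exact eq_of_exp_eq hper hw (exp_logBranch hne)
  refine ⟨G, fun z hz => ?_, hGE, fun z hz hz1 => ⟨log z / (2 * π * I), im_logBranch_pos hz hz1,
    exp_logBranch hz, rfl⟩⟩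
  obtain ⟨hzb, hz0⟩ := hz
  have hz0 : z ≠ 0 := hz0
  have hz1 : ‖z‖ < 1 := mem_ball_zero_iff.mp hzb
  have hpd : IsOpen (ball (0 : ℂ) 1 \ {0}) := isOpen_ball.sdiff isClosed_singleton
  refine DifferentiableAt.differentiableWithinAt ?_
  by_cases hs : z ∈ slitPlane
  · -- principal branch
    have hℓ : DifferentiableAt ℂ (fun z => log z / (2 * π * I)) z :=
      (differentiableAt_id.clog hs).div_const _
    have hFd : DifferentiableAt ℂ F (log z / (2 * π * I)) :=
      hF.differentiableAt (isOpen_upperHalfPlaneSet.mem_nhds (im_logBranch_pos hz0 hz1))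
    exact hFd.comp z hℓ
  · -- `z` on the negative real axis: use the branch `log (-z)/(2πi) + 1/2`
    have hs' : -z ∈ slitPlane := by
      rw [mem_slitPlane_iff] at hs ⊢
      push Not at hs
      left
      have hre : z.re ≠ 0 := fun h => hz0 (Complex.ext h hs.2)
      simp only [neg_re]
      rcases lt_or_eq_of_le hs.1 with h | h
      · linarith
      · exact absurd h hre
    let ℓ₂ : ℂ → ℂ := fun u => log (-u) / (2 * π * I) + 1 / 2
    have hℓ₂E : ∀ u : ℂ, u ≠ 0 → exp (2 * π * I * ℓ₂ u) = u := fun u hu => by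
      show exp (2 * π * I * (log (-u) / (2 * π * I) + 1 / 2)) = u
      rw [mul_add, mul_div_cancel₀ _ h2, exp_add, exp_log (neg_ne_zero.mpr hu)]
      have : (2 * π * I * (1 / 2) : ℂ) = π * I := by ring
      rw [this, exp_pi_mul_I]
      ring
    have hℓ₂im : ∀ u : ℂ, u ≠ 0 → ‖u‖ < 1 → 0 < (ℓ₂ u).im := fun u hu hu1 => by
      show 0 < (log (-u) / (2 * π * I) + 1 / 2).im
      rw [add_im, im_logBranch, norm_neg]
      have hlog : Real.log ‖u‖ < 0 := Real.log_neg (norm_pos_iff.mpr hu) hu1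
      have h2π : 0 < 2 * π := by positivity
      have h12 : ((1 : ℂ) / 2).im = 0 := by simp
      rw [h12, add_zero]
      exact div_pos (by linarith) h2π
    have hGeq : ∀ᶠ u in 𝓝 z, G u = F (ℓ₂ u) := by
      filter_upwards [hpd.mem_nhds ⟨hzb, hz0⟩] with u hu
      have hu0 : u ≠ 0 := hu.2
      have hu1 : ‖u‖ < 1 := mem_ball_zero_iff.mp hu.1
      exact eq_of_exp_eq hper (hℓ₂im u hu0 hu1)
        ((exp_logBranch hu0).trans (hℓ₂E u hu0).symm)
    refine (Filter.EventuallyEq.differentiableAt_iff hGeq).mpr ?_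
    have hℓ : DifferentiableAt ℂ ℓ₂ z :=
      ((differentiableAt_id.neg.clog hs').div_const _).add_const _
    have hFd : DifferentiableAt ℂ F (ℓ₂ z) :=
      hF.differentiableAt (isOpen_upperHalfPlaneSet.mem_nhds (hℓ₂im z hz0 hz1))
    exact hFd.comp z hℓ

end Descent

/-! ### §5 Trivial monodromy: a periodic self-map of `ℍₒ` has a limit inside `ℍₒ` at the cusp -/

/-- The Cayley transform `u ↦ (u - i)/(u + i)` maps `ℍₒ` into the unit disc. [folklore] -/
private theorem norm_cayley_lt_one {u : ℂ} (hu : 0 < u.im) : ‖(u - I) / (u + I)‖ < 1 := by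
  have hden : u + I ≠ 0 := by
    intro h; have := congrArg Complex.im h; simp at this; linarith
  rw [norm_div, div_lt_one (norm_pos_iff.mpr hden)]
  rw [← sq_lt_sq₀ (norm_nonneg _) (norm_nonneg _), ← Complex.normSq_eq_norm_sq,
    ← Complex.normSq_eq_norm_sq, Complex.normSq_apply, Complex.normSq_apply]
  simp only [sub_re, I_re, sub_zero, sub_im, I_im, add_re, add_zero, add_im]
  nlinarith

/-- The inverse Cayley transform `v ↦ i(1 + v)/(1 - v)` recovers `u` from `(u - i)/(u + i)`.
[folklore] -/
private theorem cayley_inv_apply {u : ℂ} (hu : 0 < u.im) :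
    I * (1 + (u - I) / (u + I)) / (1 - (u - I) / (u + I)) = u := by
  have hden : u + I ≠ 0 := by
    intro h; have := congrArg Complex.im h; simp at this; linarith
  have h2 : (1 : ℂ) - (u - I) / (u + I) = 2 * I / (u + I) := by
    field_simp; ring
  have h1 : (1 : ℂ) + (u - I) / (u + I) = 2 * u / (u + I) := by
    field_simp; ring
  rw [h1, h2]
  field_simp

/-- The inverse Cayley transform sends the open unit disc into `ℍₒ`:
`Im (i(1+v)/(1-v)) = (1 - |v|²)/|1 - v|² > 0`. [folklore] -/
private theorem cayley_inv_im_pos {v : ℂ} (hv : ‖v‖ < 1) : 0 < (I * (1 + v) / (1 - v)).im := by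
  have h1v : (1 : ℂ) - v ≠ 0 := by
    intro h
    have : v = 1 := by linear_combination -h
    rw [this, norm_one] at hv
    exact lt_irrefl _ hv
  have hN : 0 < Complex.normSq (1 - v) := Complex.normSq_pos.mpr h1v
  rw [Complex.div_im, div_sub_div_same]
  apply div_pos _ hN
  have hv2 : v.re * v.re + v.im * v.im < 1 := by
    have h := hv
    rw [← sq_lt_one_iff₀ (norm_nonneg _), ← Complex.normSq_eq_norm_sq, Complex.normSq_apply] at h
    exact h
  simp only [mul_re, I_re, add_re, one_re, I_im, add_im, one_im, zero_mul, one_mul, zero_sub,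
    sub_re, sub_im, zero_add, mul_im]
  nlinarith

/-- ★ **Trivial monodromy ⇒ a limit in `ℍₒ` at the cusp.**  If `F : ℍₒ → ℍₒ` is holomorphic and
`1`-periodic, then `F w → τ` as `Im w → ∞`, uniformly in `Re w`, for some `τ` with `Im τ > 0`: the
descended map `𝔻* → ℍₒ`, Cayley-transformed into the unit disc, has a removable singularity at `0`
(Riemann), and its value there lies in the OPEN disc by the maximum modulus principle.
[cite: FarkasKra1992, IV.5.5–IV.5.6] -/
theorem exists_limit_of_periodic_of_mapsTo {F : ℂ → ℂ} (hF : DifferentiableOn ℂ F upperHalfPlaneSet)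
    (hmaps : MapsTo F upperHalfPlaneSet upperHalfPlaneSet) (hper : ∀ w : ℂ, 0 < w.im → F (w + 1) = F w) :
    ∃ τ : ℂ, 0 < τ.im ∧ ∀ ε : ℝ, 0 < ε → ∃ A : ℝ, ∀ w : ℂ, A < w.im → ‖F w - τ‖ < ε := by
  obtain ⟨G, hGd, hGE, hGsurj⟩ := exists_descent_exp hper hF
  -- `G` maps the punctured disc into `ℍₒ`
  have hGpos : ∀ z : ℂ, z ≠ 0 → ‖z‖ < 1 → 0 < (G z).im := fun z hz hz1 => by
    obtain ⟨w, hw, -, hGw⟩ := hGsurj z hz hz1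
    rw [hGw]; exact hmaps hw
  -- the Cayley transform `H = C ∘ G`, bounded by `1` on the punctured disc
  let C : ℂ → ℂ := fun u => (u - I) / (u + I)
  have hCd : ∀ u : ℂ, 0 < u.im → DifferentiableAt ℂ C u := fun u hu => by
    have hden : u + I ≠ 0 := by
      intro h; have := congrArg Complex.im h; simp at this; linarith
    exact (differentiableAt_id.sub_const I).div (differentiableAt_id.add_const I) hden
  let H : ℂ → ℂ := fun z => C (G z)
  have hpd_open : IsOpen (ball (0 : ℂ) 1 \ {0}) := isOpen_ball.sdiff isClosed_singleton
  have hHd : DifferentiableOn ℂ H (ball (0 : ℂ) 1 \ {0}) := fun z hz => by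
    have hz0 : z ≠ 0 := hz.2
    have hz1 : ‖z‖ < 1 := mem_ball_zero_iff.mp hz.1
    have hG : DifferentiableAt ℂ G z := (hGd z hz).differentiableAt (hpd_open.mem_nhds hz)
    exact ((hCd (G z) (hGpos z hz0 hz1)).comp z hG).differentiableWithinAt
  have hHlt : ∀ z : ℂ, z ≠ 0 → ‖z‖ < 1 → ‖H z‖ < 1 := fun z hz hz1 =>
    norm_cayley_lt_one (hGpos z hz hz1)
  -- Riemann's removable singularity theorem at `0`
  have hev : ∀ᶠ z in 𝓝[≠] (0 : ℂ), z ∈ ball (0 : ℂ) 1 \ {0} := by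
    have hb : ball (0 : ℂ) 1 ∈ 𝓝 (0 : ℂ) := ball_mem_nhds _ one_pos
    filter_upwards [mem_nhdsWithin_of_mem_nhds hb, self_mem_nhdsWithin] with z hz hz0
    exact ⟨hz, hz0⟩
  have hHda : ∀ᶠ z in 𝓝[≠] (0 : ℂ), DifferentiableAt ℂ H z :=
    hev.mono fun z hz => (hHd z hz).differentiableAt (hpd_open.mem_nhds hz)
  have hHb : IsBoundedUnder (· ≤ ·) (𝓝[≠] (0 : ℂ)) fun z => ‖H z - H 0‖ :=
    ⟨1 + ‖H 0‖, hev.mono fun z hz =>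
      (norm_sub_le _ _).trans (by linarith [hHlt z hz.2 (mem_ball_zero_iff.mp hz.1)])⟩
  have hlim := Complex.tendsto_limUnder_of_differentiable_on_punctured_nhds_of_bounded_under hHda hHb
  set h₀ : ℂ := limUnder (𝓝[≠] (0 : ℂ)) H with hh₀
  -- the extension `Ĥ` is holomorphic on the disc
  have hbdd : BddAbove (norm ∘ H '' (ball (0 : ℂ) 1 \ {0})) :=
    ⟨1, by rintro _ ⟨z, hz, rfl⟩; exact (hHlt z hz.2 (mem_ball_zero_iff.mp hz.1)).le⟩
  have hĤd : DifferentiableOn ℂ (update H 0 h₀) (ball (0 : ℂ) 1) :=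
    Complex.differentiableOn_update_limUnder_of_bddAbove (ball_mem_nhds _ one_pos) hHd hbdd
  -- `‖h₀‖ ≤ 1`, and `< 1` by the maximum modulus principle
  have hh₀le : ‖h₀‖ ≤ 1 :=
    le_of_tendsto hlim.norm (hev.mono fun z hz => (hHlt z hz.2 (mem_ball_zero_iff.mp hz.1)).le)
  have hh₀lt : ‖h₀‖ < 1 := by
    rcases lt_or_eq_of_le hh₀le with h | h
    · exact h
    · exfalso
      have hmax : IsMaxOn (norm ∘ update H 0 h₀) (ball (0 : ℂ) 1) 0 := fun z hz => by
        by_cases hz0 : z = 0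
        · subst hz0
          show (norm ∘ update H 0 h₀) 0 ≤ (norm ∘ update H 0 h₀) 0
          exact le_rfl
        · show ‖update H 0 h₀ z‖ ≤ ‖update H 0 h₀ 0‖
          rw [update_of_ne hz0, update_self, h]
          exact (hHlt z hz0 (mem_ball_zero_iff.mp hz)).le
      have heq := Complex.eqOn_of_isPreconnected_of_isMaxOn_norm (convex_ball (0 : ℂ) 1).isPreconnected
        isOpen_ball hĤd (mem_ball_self one_pos) hmax
      have hhalf : ((1 : ℂ) / 2) ∈ ball (0 : ℂ) 1 := by
        rw [mem_ball_zero_iff]; norm_num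
      have hhalf0 : ((1 : ℂ) / 2) ≠ 0 := by norm_num
      have hval := heq hhalf
      simp only [const_apply, update_self, update_of_ne hhalf0] at hval
      have hlt := hHlt _ hhalf0 (mem_ball_zero_iff.mp hhalf)
      rw [hval, h] at hlt
      exact lt_irrefl _ hlt
  -- the limit point `τ = C⁻¹ h₀ ∈ ℍₒ`
  let Cinv : ℂ → ℂ := fun v => I * (1 + v) / (1 - v)
  have h1v : (1 : ℂ) - h₀ ≠ 0 := by
    intro h
    have : h₀ = 1 := by linear_combination -h
    rw [this, norm_one] at hh₀lt
    exact lt_irrefl _ hh₀lt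
  have hCinv_cont : ContinuousAt Cinv h₀ :=
    ((continuous_const.mul (continuous_const.add continuous_id)).continuousAt).div
      ((continuous_const.sub continuous_id).continuousAt) h1v
  refine ⟨Cinv h₀, cayley_inv_im_pos hh₀lt, fun ε hε => ?_⟩
  -- `G = Cinv ∘ H → Cinv h₀` along `𝓝[≠] 0`
  have hGlim : Tendsto G (𝓝[≠] (0 : ℂ)) (𝓝 (Cinv h₀)) := by
    have h1 : Tendsto (fun z => Cinv (H z)) (𝓝[≠] (0 : ℂ)) (𝓝 (Cinv h₀)) :=
      hCinv_cont.tendsto.comp hlim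
    refine h1.congr' (hev.mono fun z hz => ?_)
    exact cayley_inv_apply (hGpos z hz.2 (mem_ball_zero_iff.mp hz.1))
  obtain ⟨δ, hδ, hδε⟩ := Metric.tendsto_nhdsWithin_nhds.mp hGlim ε hε
  -- height `A` with `e^{-2πA} ≤ δ`
  refine ⟨max 0 (-Real.log δ / (2 * π)), fun w hw => ?_⟩
  have hw0 : 0 < w.im := lt_of_le_of_lt (le_max_left _ _) hw
  have hwA : -Real.log δ / (2 * π) < w.im := lt_of_le_of_lt (le_max_right _ _) hw
  have hnorm : ‖exp (2 * π * I * w)‖ < δ := by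
    rw [norm_exp_two_pi_I_mul, ← Real.exp_log hδ, Real.exp_lt_exp]
    have h2π : 0 < 2 * π := by positivity
    rw [div_lt_iff₀ h2π] at hwA
    linarith
  have hd := hδε (x := exp (2 * π * I * w)) (exp_ne_zero _) (by simpa using hnorm)
  rw [hGE w hw0] at hd
  simpa [dist_eq_norm] using hd

end TranslationEquivariant

end Literature.Analysis.Complex

end
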